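import Summits.CriticalPhenomena.PercolationContinuityZ3.Theorems.PercNearOneGluingNoHeavyQuantFarGate3BandU3
import Summits.CriticalPhenomena.PercolationContinuityZ3.Theorems.PercNearOneGluingNoHeavyQuantFarGate3Red8Third
import Summits.CriticalPhenomena.PercolationContinuityZ3.Theorems.PercNearOneGluingNoHeavyQuantFarGate3CornerU3Ineq
import Summits.CriticalPhenomena.PercolationContinuityZ3.Theorems.PercNearOneGluingNoHeavyQuantFarGate3CornerHandover
import HarnessLib

/-!
# QUANT lane R8, front "FAR beyond trees", layer one — THE DEGREE-THREE GATE AT THE OBSERVER, LIII: the (1,1)-CORNER at small `p` and large `σ = nn·p`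
# by closed forms — coupled ∪ U3 band ∪ crowd-plus, with Handelman certificates for the side conditions

builds on p205010 (kernel theorem, internal audit signed; external expert review pending)

Support file (`--supports stmt-CriticalPhenomena-4575`), seat `prim-quant-p1` (gen 32); memo
`run/shared/lean/prim/quant/prim-quant-p1-g32/FOR-LEAD-GATE3-CHARTC.md` §4b.  Mathlib-only on top of files XXXII (`red8_coupled`, `red8_crowdplus_star`)
and XXXVI (`red8_bandU3`); standard axioms; no sorries; no definitions.  GENERATED by `num/corner/gen_corner.py` (exact Handelman LPs, pure python).

In the two-chart architecture for small gate weights (memo §3) the box certificates of BOTH charts fail on boxes touching the corner `r₁, r₂ → 1` (where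
`Δ, K ~ w` and the closed-form multipliers blow up like `1/(wΔ)`).  For `nn·p ≥ 5/8` the corner block `r₁, r₂ ∈ [4/5, 1)`, `0 < p ≤ 1/20` is covered by
the three closed-form families already in the tree: `Δ ≤ 0` ⟹ coupled; `Δ > 0` and (R6) `nn·p·K ≤ (1−p)(1−p r₂)` ⟹ the U3 band (its other five side
conditions hold on the block: `E_α ≥ 1/2`, `Φ ≥ 1/2`, `F₁ ≥ 1/2` using (R6), `F₂ ≤ 0` using `nn·p ≥ 5/8`); `Δ > 0` and ¬(R6) ⟹ crowd-plus, because the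
U3 upper edge lies above the crowd-plus lower edges: `(1−p)(1−pr₂)(W₁₂Δ + X_C) ≥ (1−pρ)Δ·K` (TIGHT at `p = 0`: the slack is `p·(2(w₁+w₂) + O(w²)) + O(p²w)`)
and `(1−p)(1−pr₂)(w₂Δ + X_A) ≥ (1−pr₂)Δ·K`.  Each polynomial inequality is an explicit non-negative combination of products of the box constraints
`p, 1/20 − p, 1 − rᵢ, rᵢ − 4/5` (`ring` + `linarith`).
[cite: KozmaNitzan2024, Conjecture 3 (p. 15)]; [this work].
-/

noncomputable section

namespace Summit.CriticalPhenomena.PercolationContinuityZ3.Theorems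

namespace Quant

namespace Gate3


set_option maxHeartbeats 4000000 in
/-- **The (1,1)-corner at large `σ`**: for `0 < p ≤ 1/20`, `4/5 ≤ r₁ ≤ r₂ < 1` and every real `nn ≥ 0` with `nn·p ≥ 5/8`, the 8-cell cover statement
holds — by the coupled regime, the U3 band, or crowd-plus. [this work] -/
theorem red8_corner (p r₁ r₂ nn : ℝ) (hp0 : 0 < p) (hp : p ≤ 1 / 20) (h1lo : 4 / 5 ≤ r₁) (h12 : r₁ ≤ r₂) (hr2 : r₂ < 1) (hn : 0 ≤ nn)
    (hσ : 5 / 8 ≤ nn * p) :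
    ∀ (a0 a1 a2 b1 b2 c0 c1 d : ℝ), 0 ≤ a0 → 0 ≤ a1 → 0 ≤ a2 → 0 ≤ b1 → 0 ≤ b2 → 0 ≤ c0 → 0 ≤ c1 → 0 ≤ d →
    b1 * (b2 + (c0 + c1)) ≤ (a0 + a1 + a2) * d →
    b2 * (b1 + (c0 + c1)) ≤ (a0 + a1 + a2) * d →
    (c0 + c1) * (b1 + b2) ≤ (a0 + a1 + a2) * d →
    b1 * (a1 + a2 + c1 + d) ≤ d * (a0 + b1 + b2 + c0) →
    b2 * (a1 + a2 + c1 + d) ≤ d * (a0 + b1 + b2 + c0) →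
    c0 * (a1 + a2 + c1 + d) ≤ (c1 + d) * (a0 + b1 + b2 + c0) →
    0 < p * ((1 - r₁) * (1 - r₂)) * (a0 + c0) - (1 - p) * a2 - (1 - p) * ((1 - r₁) * (1 - r₂)) * d →
    0 < (1 - p) * (1 - r₁) * b1 - p * (r₂ * (1 - r₁)) * a0 - p * (1 - r₁) * a1 - (1 - p * r₁) * a2 - (1 - (1 - p) * (1 - r₂)) * (1 - r₁) * b2 - p * ((1 - r₁) * (1 - r₂)) * c1 →
    0 < (1 - p) * (1 - r₂) * b2 - p * (r₁ * (1 - r₂)) * a0 - p * (1 - r₂) * a1 - (1 - p * r₂) * a2 - (1 - (1 - p) * (1 - r₁)) * (1 - r₂) * b1 - p * ((1 - r₁) * (1 - r₂)) * c1 →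
    0 < (1 - p * max r₁ r₂ - nn * p * (1 - max r₁ r₂)) * a1 + (1 - p * (r₁ + r₂ * (1 - r₁)) - nn * p * ((1 - r₁) * (1 - r₂))) * c1 - nn * p * (r₁ + r₂ * (1 - r₁) - max r₁ r₂) * a0 - nn * ((1 - (1 - p) * (1 - r₁)) * (1 - r₂)) * b1 - nn * ((1 - (1 - p) * (1 - r₂)) * (1 - r₁)) * b2 →
    0 < (p * (1 + r₁ + r₂ + nn * max r₁ r₂) - 2) * a0 + (p * (1 + r₁ + r₂) + p * max r₁ r₂ * (nn - 1) - 1) * a1 + (p * (1 + r₁ + r₂) + nn - 2) * a2 + ((1 - (1 - p) * (1 - r₁)) * (1 + r₂ * (nn + 1)) - 1) * b1 + ((1 - (1 - p) * (1 - r₂)) * (1 + r₁ * (nn + 1)) - 1) * b2 + (p * (1 + (nn + 2) * (r₁ + r₂ * (1 - r₁))) - 2) * c0 + (p * (1 + (nn + 1) * (r₁ + r₂ * (1 - r₁))) - 1) * c1 + (nn + 1 - (1 - p) * ((1 - r₁) * (1 - r₂))) * d →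
    False := by
  have h1hi : r₁ ≤ 1 := by linarith
  have hr11 : r₁ < 1 := lt_of_le_of_lt h12 hr2
  have h2lo : 4 / 5 ≤ r₂ := le_trans h1lo h12
  have h2hi : r₂ ≤ 1 := hr2.le
  have hq : 0 < 1 - p := by linarith
  have hw2 : 0 < 1 - r₂ := by linarith
  have hw1 : 0 ≤ 1 - r₁ := by linarith
  -- K = (1 - r₁ r₂) - p r₁ (1 - r₂) = (1 - r₁) + r₁ (1 - r₂) (1 - p) > 0
  have hK : 0 < (1 - r₁ * r₂) - p * r₁ * (1 - r₂) := by nlinarith [mul_pos (mul_pos (by linarith : (0 : ℝ) < r₁) hw2) hq]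
  by_cases hΔ : ((1 - p) ^ 2 - (1 - (1 - p) * (1 - r₁)) * (1 - (1 - p) * (1 - r₂))) ≤ 0
  · exact red8_coupled p r₁ r₂ nn hp0.le (by linarith) (by linarith) hr11 (by linarith) h2hi hΔ
  push Not at hΔ
  have hEa := corner_Ea p r₁ r₂ hp0.le hp h1lo h1hi h2lo h2hi
  have hPhi := corner_Phi p r₁ r₂ hp0.le hp h1lo h1hi h2lo h2hi
  have hF1 := corner_F1 p r₁ r₂ hp0.le hp h1lo h1hi h2lo h2hi
  have hF2 := corner_F2 p r₁ r₂ hp0.le hp h1lo h1hi h2lo h2hi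
  have hGA := corner_GA p r₁ r₂ hp0.le hp h1lo h1hi h2lo h2hi
  have hGC := corner_GC p r₁ r₂ hp0.le hp h1lo h1hi h2lo h2hi
  by_cases hR6 : nn * p * ((1 - r₁ * r₂) - p * r₁ * (1 - r₂)) ≤ (1 - p) * (1 - p * r₂)
  · -- the U3 band
    refine red8_bandU3 p r₁ r₂ nn hp0 (by linarith) (by linarith) h12 hr2 hn hΔ ?_ ?_ hR6 ?_ ?_
    · -- E_α > 0
      have e : (r₁ + r₁ * r₂ - 2 * p * r₁ + p * r₂ - p * r₁ * r₂ - p * r₁ * r₂ ^ 2 - p * r₁ ^ 2 + p * r₁ ^ 2 * r₂ + p ^ 2 * r₁ ^ 2 - p ^ 2 * r₁ ^ 2 * r₂ + p ^ 2 * r₁ * r₂ ^ 2 + p ^ 2 * r₁ * r₂ - p ^ 2 * r₂ ^ 2) = (((3 : ℝ) / 2) + (-1 : ℝ) * (1 - r₂) + (-2 : ℝ) * (1 - r₁) + (1 : ℝ) * (1 - r₁) * (1 - r₂) + (-3 : ℝ) * p + (1 : ℝ) * p * (1 - r₂) + (-1 : ℝ) * p * (1 - r₂) ^ 2 + (4 :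 ℝ) * p * (1 - r₁) + (-1 : ℝ) * p * (1 - r₁) * (1 - r₂) + (1 : ℝ) * p * (1 - r₁) * (1 - r₂) ^ 2 + (-1 : ℝ) * p * (1 - r₁) ^ 2 * (1 - r₂) + (1 : ℝ) * p ^ 2 + (-2 : ℝ) * p ^ 2 * (1 - r₁) + (1 : ℝ) * p ^ 2 * (1 - r₁) * (1 - r₂) + (-1 : ℝ) * p ^ 2 * (1 - r₁) * (1 - r₂) ^ 2 + (1 : ℝ) * p ^ 2 * (1 - r₁) ^ 2 * (1 - r₂)) + 1 / 2 := by ring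
      linarith
    · -- Φ ≥ 0
      have e : (3 * (1 - p) ^ 2 * r₁ * r₂ + (1 - p ^ 2) * (r₁ + r₂) - (1 - 2 * p)) = (((7 : ℝ) / 2) + (-4 : ℝ) * (1 - r₂) + (-4 : ℝ) * (1 - r₁) + (3 : ℝ) * (1 - r₁) * (1 - r₂) + (-4 : ℝ) * p + (6 : ℝ) * p * (1 - r₂) + (6 : ℝ) * p * (1 - r₁) + (-6 : ℝ) * p * (1 - r₁) * (1 - r₂) + (1 : ℝ) * p ^ 2 + (-2 : ℝ) * p ^ 2 * (1 - r₂) + (-2 : ℝ) * p ^ 2 * (1 - r₁) + (3 : ℝ) * p ^ 2 * (1 - r₁) * (1 - r₂)) + 1 / 2 := by ring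
      linarith
    · -- F₁ ≥ 0 : F₁ = C₁ − nn·p·(r₂ − r₁)·K ≥ C₁ − (r₂ − r₁)(1−p)(1−pr₂) ≥ 1/2
      have hm : (r₂ - r₁) * (nn * p * ((1 - r₁ * r₂) - p * r₁ * (1 - r₂))) ≤ (r₂ - r₁) * ((1 - p) * (1 - p * r₂)) :=
        mul_le_mul_of_nonneg_left hR6 (by linarith)
      have e : (nn * p ^ 2 * r₁ ^ 2 * r₂ - nn * p ^ 2 * r₁ ^ 2 - nn * p ^ 2 * r₁ * r₂ ^ 2 + nn * p ^ 2 * r₁ * r₂ - nn * p * r₁ ^ 2 * r₂ + nn * p * r₁ * r₂ ^ 2 + nn * p * r₁ - nn * p * r₂ - p ^ 2 * r₁ ^ 2 * r₂ + p ^ 2 * r₁ ^ 2 + p ^ 2 * r₁ * r₂ ^ 2 + p ^ 2 * r₁ * r₂ + p * r₁ ^ 2 * r₂ - p * r₁ ^ 2 - p * r₁ * r₂ ^ 2 - 2 * p * r₁ * r₂ - 2 * p * r₁ - p * r₂ ^ 2 + 2 * r₁ * r₂ + r₁ + r₂) = ((((7 : ℝ) / 2) + (-2 : ℝ) * (1 -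 r₂) + (-4 : ℝ) * (1 - r₁) + (2 : ℝ) * (1 - r₁) * (1 - r₂) + (-6 : ℝ) * p + (3 : ℝ) * p * (1 - r₂) + (-1 : ℝ) * p * (1 - r₂) ^ 2 + (7 : ℝ) * p * (1 - r₁) + (-3 : ℝ) * p * (1 - r₁) * (1 - r₂) + (1 : ℝ) * p * (1 - r₁) * (1 - r₂) ^ 2 + (-1 : ℝ) * p * (1 - r₁) ^ 2 * (1 - r₂) + (2 : ℝ) * p ^ 2 + (-1 : ℝ) * p ^ 2 * (1 - r₂) + (-3 : ℝ) * p ^ 2 * (1 - r₁) + (2 : ℝ) * p ^ 2 * (1 - r₁) * (1 - r₂) + (-1 : ℝ) * p ^ 2 * (1 - r₁) * (1 - r₂) ^ 2 + (1 : ℝ) * p ^ 2 * (1 - r₁) ^ 2 * (1 - r₂)) + 1 / 2) + ((r₂ - r₁) * ((1 - p) * (1 - p * r₂)) - (r₂ - r₁) * (nn * p * ((1 - r₁ * r₂) - p * r₁ * (1 - r₂)))) := by ring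
      linarith
    · -- F₂ ≤ 0 : F₂ = A − nn·p·(1 + (1−p)r₁)·K ≤ A − (5/8)(1 + (1−p)r₁)·K ≤ 0
      have hpos : 0 ≤ (1 + (1 - p) * r₁) * ((1 - r₁ * r₂) - p * r₁ * (1 - r₂)) := by nlinarith
      have hm : 5 / 8 * ((1 + (1 - p) * r₁) * ((1 - r₁ * r₂) - p * r₁ * (1 - r₂))) ≤ nn * p * ((1 + (1 - p) * r₁) * ((1 - r₁ * r₂) - p * r₁ * (1 - r₂))) :=
        mul_le_mul_of_nonneg_right hσ hpos
      have e : (nn * p ^ 3 * r₁ ^ 2 * r₂ - nn * p ^ 3 * r₁ ^ 2 - 2 * nn * p ^ 2 * r₁ ^ 2 * r₂ + nn * p ^ 2 * r₁ ^ 2 - nn * p ^ 2 * r₁ * r₂ + 2 * nn * p ^ 2 * r₁ + nn * p * r₁ ^ 2 * r₂ + nn * p * r₁ * r₂ - nn * p * r₁ - nn * p + p ^ 3 * r₁ * r₂ ^ 2 - p ^ 3 * r₁ * r₂ - p ^ 3 * r₂ ^ 2 - 2 * p ^ 2 * r₁ * r₂ ^ 2 + p ^ 2 * r₁ + p ^ 2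 * r₂ ^ 2 + 3 * p ^ 2 * r₂ + p * r₁ * r₂ ^ 2 + 2 * p * r₁ * r₂ - p * r₁ - 2 * p * r₂ - 2 * p - r₁ * r₂ + 1) = -(((1 : ℝ) / 4) * (1 - r₂) + ((1 : ℝ) / 4) * (1 - r₁) + ((-7 : ℝ) / 8) * (1 - r₁) * (1 - r₂) + ((-5 : ℝ) / 8) * (1 - r₁) ^ 2 + ((5 : ℝ) / 8) * (1 - r₁) ^ 2 * (1 - r₂) + (2 : ℝ) * p + ((1 : ℝ) / 8) * p * (1 - r₂) + (-1 : ℝ) * p * (1 - r₂) ^ 2 + ((11 : ℝ) / 8) * p * (1 - r₁) + ((-7 : ℝ) / 8) * p * (1 - r₁) * (1 - r₂) + (1 : ℝ) * p * (1 - r₁) * (1 - r₂) ^ 2 + ((5 : ℝ) / 8) * p * (1 - r₁) ^ 2 + ((-5 : ℝ) / 4) * p * (1 - r₁) ^ 2 * (1 - r₂) + (-3 : ℝ) * p ^ 2 + ((13 : ℝ) / 8) * p ^ 2 * (1 - r₂) + (1 : ℝ) * p ^ 2 * (1 - r₂) ^ 2 + (-1 : ℝ) * p ^ 2 * (1 -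 r₁) + ((11 : ℝ) / 4) * p ^ 2 * (1 - r₁) * (1 - r₂) + (-2 : ℝ) * p ^ 2 * (1 - r₁) * (1 - r₂) ^ 2 + ((5 : ℝ) / 8) * p ^ 2 * (1 - r₁) ^ 2 * (1 - r₂) + (1 : ℝ) * p ^ 3 + (-1 : ℝ) * p ^ 3 * (1 - r₂) + (-1 : ℝ) * p ^ 3 * (1 - r₁) * (1 - r₂) + (1 : ℝ) * p ^ 3 * (1 - r₁) * (1 - r₂) ^ 2) - (nn * p * ((1 + (1 - p) * r₁) * ((1 - r₁ * r₂) - p * r₁ * (1 - r₂))) - 5 / 8 * ((1 + (1 - p) * r₁) * ((1 - r₁ * r₂) - p * r₁ * (1 - r₂)))) := by ring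
      linarith
  · -- crowd-plus: ¬R6 and the two handover inequalities
    push Not at hR6
    have hX_A : 0 ≤ (1 - r₂) * ((1 - p) ^ 2 - (1 - (1 - p) * (1 - r₁)) * (1 - (1 - p) * (1 - r₂))) + ((1 - (1 - p) * (1 - r₁)) * ((1 - p) * (1 - r₁ * r₂) + p * (1 - r₁)) + (1 - (1 - p) * (1 - r₂)) * ((1 - p) * (1 - r₁ * r₂) + p * (1 - r₂))) := by
      have s1 : 0 ≤ 1 - (1 - p) * (1 - r₁) := by nlinarith
      have s2 : 0 ≤ 1 - (1 - p) * (1 - r₂) := by nlinarith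
      have m1 : 0 ≤ (1 - p) * (1 - r₁ * r₂) + p * (1 - r₁) := by nlinarith
      have m2 : 0 ≤ (1 - p) * (1 - r₁ * r₂) + p * (1 - r₂) := by nlinarith
      have := mul_nonneg hw2.le hΔ.le
      positivity
    have hX_C : 0 ≤ ((1 - r₁) * (1 - r₂)) * ((1 - p) ^ 2 - (1 - (1 - p) * (1 - r₁)) * (1 - (1 - p) * (1 - r₂))) + ((1 - r₂) * (1 - (1 - p) * (1 - r₁)) * ((1 - p) * (1 - r₁ * r₂) + p * (1 - r₁)) + (1 - r₁) * (1 - (1 - p) * (1 - r₂)) * ((1 - p) * (1 - r₁ * r₂) + p * (1 - r₂))) := by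
      have s1 : 0 ≤ 1 - (1 - p) * (1 - r₁) := by nlinarith
      have s2 : 0 ≤ 1 - (1 - p) * (1 - r₂) := by nlinarith
      have m1 : 0 ≤ (1 - p) * (1 - r₁ * r₂) + p * (1 - r₁) := by nlinarith
      have m2 : 0 ≤ (1 - p) * (1 - r₁ * r₂) + p * (1 - r₂) := by nlinarith
      have := mul_nonneg (mul_nonneg hw1 hw2.le) hΔ.le
      positivity
    refine red8_crowdplus_star p r₁ r₂ nn hp0.le (by linarith) (by linarith) hr11 (by linarith) hr2 hn hΔ ?_ ?_
    · -- (A*)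
      rw [max_eq_right h12]
      have h2 := mul_le_mul_of_nonneg_right hR6.le hX_A
      have eA : (2 : ℝ) * (1 - r₂) + (-1 : ℝ) * (1 - r₂) ^ 2 + (2 : ℝ) * (1 - r₁) + (-5 : ℝ) * (1 - r₁) * (1 - r₂) + (2 : ℝ) * (1 - r₁) * (1 - r₂) ^ 2 + (-2 : ℝ) * (1 - r₁) ^ 2 + (3 : ℝ) * (1 - r₁) ^ 2 * (1 - r₂) + (-1 : ℝ) * (1 - r₁) ^ 2 * (1 - r₂) ^ 2 + (-5 : ℝ) * p * (1 - r₂) + (5 : ℝ) * p * (1 - r₂) ^ 2 + (-1 : ℝ) * p * (1 - r₂) ^ 3 + (-3 : ℝ) * p * (1 - r₁) + (16 : ℝ) * p * (1 - r₁) * (1 - r₂) + (-12 : ℝ) * p * (1 - r₁) * (1 - r₂) ^ 2 + (2 : ℝ) * p * (1 - r₁) * (1 - r₂) ^ 3 + (5 : ℝ) * p * (1 - r₁) ^ 2 + (-12 : ℝ) * p * (1 - r₁) ^ 2 * (1 - r₂) + (7 : ℝ) * p * (1 - r₁) ^ 2 * (1 - r₂) ^ 2 + (-1 : ℝ) * p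 * (1 - r₁) ^ 2 * (1 - r₂) ^ 3 + (4 : ℝ) * p ^ 2 * (1 - r₂) + (-6 : ℝ) * p ^ 2 * (1 - r₂) ^ 2 + (2 : ℝ) * p ^ 2 * (1 - r₂) ^ 3 + (1 : ℝ) * p ^ 2 * (1 - r₁) + (-15 : ℝ) * p ^ 2 * (1 - r₁) * (1 - r₂) + (18 : ℝ) * p ^ 2 * (1 - r₁) * (1 - r₂) ^ 2 + (-5 : ℝ) * p ^ 2 * (1 - r₁) * (1 - r₂) ^ 3 + (-4 : ℝ) * p ^ 2 * (1 - r₁) ^ 2 + (15 : ℝ) * p ^ 2 * (1 - r₁) ^ 2 * (1 - r₂) + (-13 : ℝ) * p ^ 2 * (1 - r₁) ^ 2 * (1 - r₂) ^ 2 + (3 : ℝ) * p ^ 2 * (1 - r₁) ^ 2 * (1 - r₂) ^ 3 + (-1 : ℝ) * p ^ 3 * (1 - r₂) + (2 : ℝ) * p ^ 3 * (1 - r₂) ^ 2 + (-1 : ℝ) * p ^ 3 * (1 - r₂) ^ 3 + (6 : ℝ) * p ^ 3 * (1 - r₁) * (1 - r₂) + (-10 : ℝ) * p ^ 3 * (1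 - r₁) * (1 - r₂) ^ 2 + (4 : ℝ) * p ^ 3 * (1 - r₁) * (1 - r₂) ^ 3 + (1 : ℝ) * p ^ 3 * (1 - r₁) ^ 2 + (-7 : ℝ) * p ^ 3 * (1 - r₁) ^ 2 * (1 - r₂) + (9 : ℝ) * p ^ 3 * (1 - r₁) ^ 2 * (1 - r₂) ^ 2 + (-3 : ℝ) * p ^ 3 * (1 - r₁) ^ 2 * (1 - r₂) ^ 3 + (-1 : ℝ) * p ^ 4 * (1 - r₁) * (1 - r₂) + (2 : ℝ) * p ^ 4 * (1 - r₁) * (1 - r₂) ^ 2 + (-1 : ℝ) * p ^ 4 * (1 - r₁) * (1 - r₂) ^ 3 + (1 : ℝ) * p ^ 4 * (1 - r₁) ^ 2 * (1 - r₂) + (-2 : ℝ) * p ^ 4 * (1 - r₁) ^ 2 * (1 - r₂) ^ 2 + (1 : ℝ) * p ^ 4 * (1 - r₁) ^ 2 * (1 - r₂) ^ 3 = ((1 - p) * (1 - p * r₂)) * ((1 - r₂) * ((1 - p) ^ 2 - (1 - (1 - p) * (1 - r₁)) * (1 - (1 - p) * (1 - r₂))) + ((1 - (1 - p) * (1 -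 r₁)) * ((1 - p) * (1 - r₁ * r₂) + p * (1 - r₁)) + (1 - (1 - p) * (1 - r₂)) * ((1 - p) * (1 - r₁ * r₂) + p * (1 - r₂)))) - (1 - p * r₂) * ((1 - p) ^ 2 - (1 - (1 - p) * (1 - r₁)) * (1 - (1 - p) * (1 - r₂))) * ((1 - r₁ * r₂) - p * r₁ * (1 - r₂)) := by ring
      -- K · ((1 − p r₂)Δ − nn p (w₂Δ + X_A)) ≤ 0
      have h3 : ((1 - r₁ * r₂) - p * r₁ * (1 - r₂)) * ((1 - p * r₂) * ((1 - p) ^ 2 - (1 - (1 - p) * (1 - r₁)) * (1 - (1 - p) * (1 - r₂))) - nn * p * ((1 - r₂) * ((1 - p) ^ 2 - (1 - (1 - p) * (1 - r₁)) * (1 - (1 - p) * (1 - r₂))) + ((1 - (1 - p) * (1 - r₁)) * ((1 - p) * (1 - r₁ * r₂) + p * (1 - r₁)) + (1 - (1 - p) * (1 - r₂)) * ((1 - p) * (1 - r₁ * r₂) + p * (1 - r₂))))) ≤ 0 := by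
        nlinarith
      have h4 : (1 - p * r₂) * ((1 - p) ^ 2 - (1 - (1 - p) * (1 - r₁)) * (1 - (1 - p) * (1 - r₂))) - nn * p * ((1 - r₂) * ((1 - p) ^ 2 - (1 - (1 - p) * (1 - r₁)) * (1 - (1 - p) * (1 - r₂))) + ((1 - (1 - p) * (1 - r₁)) * ((1 - p) * (1 - r₁ * r₂) + p * (1 - r₁)) + (1 - (1 - p) * (1 - r₂)) * ((1 - p) * (1 - r₁ * r₂) + p * (1 - r₂)))) ≤ 0 := by
        by_contra hh
        push Not at hh
        have := mul_pos hK hh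
        linarith
      nlinarith
    · -- (C*)
      have h2 := mul_le_mul_of_nonneg_right hR6.le hX_C
      have eC : (2 : ℝ) * p * (1 - r₂) + (1 : ℝ) * p * (1 - r₂) ^ 3 + (2 : ℝ) * p * (1 - r₁) + (-3 : ℝ) * p * (1 - r₁) * (1 - r₂) + (2 : ℝ) * p * (1 - r₁) * (1 - r₂) ^ 2 + (-3 : ℝ) * p * (1 - r₁) * (1 - r₂) ^ 3 + (-1 : ℝ) * p * (1 - r₁) ^ 2 + (2 : ℝ) * p * (1 - r₁) ^ 2 * (1 - r₂) + (-4 : ℝ) * p * (1 - r₁) ^ 2 * (1 - r₂) ^ 2 + (3 : ℝ) * p * (1 - r₁) ^ 2 * (1 - r₂) ^ 3 + (-1 : ℝ) * p * (1 - r₁) ^ 3 * (1 - r₂) + (2 : ℝ) * p * (1 - r₁) ^ 3 * (1 - r₂) ^ 2 + (-1 : ℝ) * p * (1 - r₁) ^ 3 * (1 - r₂) ^ 3 + (-5 : ℝ) * p ^ 2 * (1 - r₂) + (-2 : ℝ) * p ^ 2 * (1 - r₂) ^ 3 + (-3 : ℝ) * p ^ 2 * (1 - r₁) + (8 : ℝ)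 * p ^ 2 * (1 - r₁) * (1 - r₂) + (-2 : ℝ) * p ^ 2 * (1 - r₁) * (1 - r₂) ^ 2 + (7 : ℝ) * p ^ 2 * (1 - r₁) * (1 - r₂) ^ 3 + (2 : ℝ) * p ^ 2 * (1 - r₁) ^ 2 + (-3 : ℝ) * p ^ 2 * (1 - r₁) ^ 2 * (1 - r₂) + (6 : ℝ) * p ^ 2 * (1 - r₁) ^ 2 * (1 - r₂) ^ 2 + (-8 : ℝ) * p ^ 2 * (1 - r₁) ^ 2 * (1 - r₂) ^ 3 + (1 : ℝ) * p ^ 2 * (1 - r₁) ^ 3 * (1 - r₂) + (-4 : ℝ) * p ^ 2 * (1 - r₁) ^ 3 * (1 - r₂) ^ 2 + (3 : ℝ) * p ^ 2 * (1 - r₁) ^ 3 * (1 - r₂) ^ 3 + (4 : ℝ) * p ^ 3 * (1 - r₂) + (1 : ℝ) * p ^ 3 * (1 - r₂) ^ 3 + (1 : ℝ) * p ^ 3 * (1 - r₁) + (-7 : ℝ) * p ^ 3 * (1 - r₁) * (1 - r₂) + (-5 : ℝ) * p ^ 3 * (1 - r₁) * (1 - r₂) ^ 3 + (-1 : ℝ)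 * p ^ 3 * (1 - r₁) ^ 2 + (3 : ℝ) * p ^ 3 * (1 - r₁) ^ 2 * (1 - r₂) + (-2 : ℝ) * p ^ 3 * (1 - r₁) ^ 2 * (1 - r₂) ^ 2 + (7 : ℝ) * p ^ 3 * (1 - r₁) ^ 2 * (1 - r₂) ^ 3 + (2 : ℝ) * p ^ 3 * (1 - r₁) ^ 3 * (1 - r₂) ^ 2 + (-3 : ℝ) * p ^ 3 * (1 - r₁) ^ 3 * (1 - r₂) ^ 3 + (-1 : ℝ) * p ^ 4 * (1 - r₂) + (2 : ℝ) * p ^ 4 * (1 - r₁) * (1 - r₂) + (1 : ℝ) * p ^ 4 * (1 - r₁) * (1 - r₂) ^ 3 + (-1 : ℝ) * p ^ 4 * (1 - r₁) ^ 2 * (1 - r₂) + (-2 : ℝ) * p ^ 4 * (1 - r₁) ^ 2 * (1 - r₂) ^ 3 + (1 : ℝ) * p ^ 4 * (1 - r₁) ^ 3 * (1 - r₂) ^ 3 = ((1 - p) * (1 - p * r₂)) * (((1 - r₁) * (1 - r₂)) * ((1 - p) ^ 2 - (1 - (1 - p) * (1 - r₁)) * (1 - (1 - p) * (1 - r₂)))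 + ((1 - r₂) * (1 - (1 - p) * (1 - r₁)) * ((1 - p) * (1 - r₁ * r₂) + p * (1 - r₁)) + (1 - r₁) * (1 - (1 - p) * (1 - r₂)) * ((1 - p) * (1 - r₁ * r₂) + p * (1 - r₂)))) - (1 - p * (r₁ + r₂ * (1 - r₁))) * ((1 - p) ^ 2 - (1 - (1 - p) * (1 - r₁)) * (1 - (1 - p) * (1 - r₂))) * ((1 - r₁ * r₂) - p * r₁ * (1 - r₂)) := by ring
      have h3 : ((1 - r₁ * r₂) - p * r₁ * (1 - r₂)) * ((1 - p * (r₁ + r₂ * (1 - r₁))) * ((1 - p) ^ 2 - (1 - (1 - p) * (1 - r₁)) * (1 - (1 - p) * (1 - r₂))) - nn * p * (((1 - r₁) * (1 - r₂)) * ((1 - p) ^ 2 - (1 - (1 - p) * (1 - r₁)) * (1 - (1 - p) * (1 - r₂))) + ((1 - r₂) * (1 - (1 - p) * (1 - r₁)) * ((1 - p) * (1 - r₁ * r₂) + p * (1 - r₁)) + (1 - r₁) * (1 - (1 - p) * (1 - r₂)) * ((1 - p) * (1 - r₁ * r₂) + p * (1 - r₂))))) ≤ 0 := by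
        nlinarith
      have h4 : (1 - p * (r₁ + r₂ * (1 - r₁))) * ((1 - p) ^ 2 - (1 - (1 - p) * (1 - r₁)) * (1 - (1 - p) * (1 - r₂))) - nn * p * (((1 - r₁) * (1 - r₂)) * ((1 - p) ^ 2 - (1 - (1 - p) * (1 - r₁)) * (1 - (1 - p) * (1 - r₂))) + ((1 - r₂) * (1 - (1 - p) * (1 - r₁)) * ((1 - p) * (1 - r₁ * r₂) + p * (1 - r₁)) + (1 - r₁) * (1 - (1 - p) * (1 - r₂)) * ((1 - p) * (1 - r₁ * r₂) + p * (1 - r₂)))) ≤ 0 := by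
        by_contra hh
        push Not at hh
        have := mul_pos hK hh
        linarith
      nlinarith

end Gate3

end Quant

end Summit.CriticalPhenomena.PercolationContinuityZ3.Theorems
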